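import Mathlib
import Summits.Ventures.PercRepro2.Defs
import Summits.Ventures.PercRepro2.Graph
import Summits.Ventures.PercRepro2.HullDefs
import Summits.Ventures.PercRepro2.Switching
import Summits.Ventures.PercRepro2.LastVertex
import Summits.Ventures.PercRepro2.ReimerIncreasing
import Summits.Ventures.PercRepro2.ReimerDecreasing
import Summits.Ventures.PercRepro2.TwoClusterBK
import Summits.Ventures.PercRepro2.OneSidedBase
import Summits.Ventures.PercRepro2.RigidOneSided
import Summits.Ventures.PercRepro2.TypedRigidOneSided
import Summits.Ventures.PercRepro2.TypedRigidOneSidedPinned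

/-!
# The pinned typed (RO) with a PIN FLIP at the avoided vertex (blind cell PercRepro2, night-4 g7,
2026-08-25; proofs/NIGHT4-G7.md §7.1, §8f)

The 2-cut composition asks side 1 for the typed (RO) with the virtual edge `e = uv` changing its
state from red to blue when side 2 is swapped.  When the avoided vertex `h` is an endpoint of every
red pin (the pins are the virtual edges at the cut), the same-pin permutation of
`TypedRigidOneSidedPinned.lean` composed with the recolouring of the red pins to blue gives the
transition `R → B`: on the class `{h ∉ C_R(u)}` no red pin at `h` touches `C_R(u)`, so recolouring
them blue leaves the red cluster of `u` — hence the typed condition — unchanged, keeps `h` outside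
it, and does not touch the free edges.  `exists_typedRigidOneSidedPinned_flip`.
-/

namespace Summit.Ventures.PercRepro2

namespace TypedROP

open Hull

open scoped Classical

variable {V : Type*} {E : Type*} [Fintype E] [DecidableEq E] (ends : E → Sym2 V)

/-- Recolour the edges of `P` blue. -/
def unpin (P : Finset E) (ζ : Config E) : Config E := fun e => if e ∈ P then false else ζ e

omit [Fintype E] in
/-- `unpin` is injective on configurations that are red on `P`. -/
lemma unpin_injOn (P : Finset E) {ζ η : Config E} (hζ : ∀ e ∈ P, ζ e = true)
    (hη : ∀ e ∈ P, η e = true) (h : unpin P ζ = unpin P η) : ζ = η := by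
  funext e
  by_cases he : e ∈ P
  · rw [hζ e he, hη e he]
  · have := congrFun h e
    simpa [unpin, he] using this

omit [Fintype E] in
/-- An edge of `P` with an endpoint outside the red cluster of `u` in `ζ` is not inside it, so the
red cluster of `u` is unchanged by recolouring `P` blue when every edge of `P` has an endpoint `h`
outside the cluster. -/
lemma cluster_unpin_eq (P : Finset E) {u h : V} {ζ : Config E} (hP : ∀ e ∈ P, h ∈ ends e)
    (hh : h ∉ cluster ends ζ u) : cluster ends (unpin P ζ) u = cluster ends ζ u := by
  apply Set.Subset.antisymm
  · exact cluster_mono (fun e => by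
      by_cases he : e ∈ P
      · simp [unpin, he]
      · simp [unpin, he]) u
  · intro x hx
    refine mem_of_conn_of_closed (ends := ends) (ω := ζ)
      (S := {y | y ∈ cluster ends ζ u ∧ y ∈ cluster ends (unpin P ζ) u})
      ?_ ⟨mem_cluster_self _ _ _, mem_cluster_self _ _ _⟩ hx |>.2
    rintro y ⟨hy₁, hy₂⟩ z hyz
    obtain ⟨_, e, he, hends⟩ := openGraph_adj.1 hyz
    have hz₁ : z ∈ cluster ends ζ u := mem_cluster_of_adj hy₁ hyz
    have heP : e ∉ P := by
      intro heP
      have hhe := hP e heP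
      rw [hends] at hhe
      rcases Sym2.mem_iff.1 hhe with rfl | rfl
      · exact hh hy₁
      · exact hh hz₁
    have he' : unpin P ζ e = true := by simp [unpin, heP, he]
    exact ⟨hz₁, mem_cluster_of_edge (ends := ends) hy₂ (e := e) he' hends⟩

/-- **The pinned typed (RO) with the pin flip `R → B`**: when every red pin has the avoided vertex
`h` as an endpoint, an injection of the red-pinned class into the blue-pinned class under which
every free red edge inside `C_R(h)` is blue in the image. -/
theorem exists_typedRigidOneSidedPinned_flip {P PB : Finset E} (hd : Disjoint P PB) (u h : V)
    (hP : ∀ e ∈ P, h ∈ ends e) {𝓤 : Set (Set V)} (h𝓤 : IsUpperSet 𝓤) :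
    ∃ f : {ζ // ζ ∈ tClassP ends P PB u h 𝓤} → Config E, Function.Injective f ∧
      ∀ x, f x ∈ tClassP ends ∅ (P ∪ PB) u h 𝓤 ∧
        ∀ e, e ∈ within ends (cluster ends x.1 h) → x.1 e = true → e ∉ P ∪ PB → f x e = false := by
  obtain ⟨g, hg, hgt⟩ := exists_typedRigidOneSidedPinned ends hd u h h𝓤
  refine ⟨fun x => unpin P (g x), ?_, fun x => ⟨?_, ?_⟩⟩
  · intro x y hxy
    have hx : g x ∈ tClassP ends P PB u h 𝓤 := (hgt x).1
    have hy : g y ∈ tClassP ends P PB u h 𝓤 := (hgt y).1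
    simp only [tClassP, Finset.mem_filter, Finset.mem_univ, true_and] at hx hy
    exact hg (unpin_injOn P hx.1.1 hy.1.1 hxy)
  · have hgx : g x ∈ tClassP ends P PB u h 𝓤 := (hgt x).1
    simp only [tClassP, Finset.mem_filter, Finset.mem_univ, true_and] at hgx ⊢
    obtain ⟨⟨hred, hblue⟩, hU, hh⟩ := hgx
    have hcl := cluster_unpin_eq ends P hP hh
    refine ⟨⟨fun e he => absurd he (by simp), fun e he => ?_⟩, ?_, ?_⟩
    · rcases Finset.mem_union.1 he with h1 | h1
      · simp [unpin, h1]
      · simp [unpin, hblue e h1]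
    · rw [hcl]; exact hU
    · rw [hcl]; exact hh
  · intro e he hred hfree
    have := (hgt x).2 e he hred hfree
    have heP : e ∉ P := fun h' => hfree (Finset.mem_union_left _ h')
    simp [unpin, heP, this]

end TypedROP

end Summit.Ventures.PercRepro2
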